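import Summits.Parity.BatemanHorn.Theses.LambertRoots

/-!
# Birth skeleton — crux `DeepTail` (route `LambertRoots`, item `stmt-Parity-16277`)

Line `birth` (skeleton registrar, BC3).  Notation of the route file: a Bateman–Horn system
`f = (f₁,…,f_k)`, `F(n) = ∏ᵢ fᵢ(n)` (as `toNat`s), divisor tuples `d = (dᵢ)`, `dᵢ ∣ fᵢ(n)`,
`L = lcm(d)`, weight `w(d) = ∏ᵢ μ(dᵢ) log dᵢ`, smoothing `e^{-n/x}` over `n ≤ x²`.  The crux is

  `Deep_η(x) := Σ_{n ≤ x²} e^{-n/x} Σ_{d : dᵢ ∣ fᵢ(n), L > x^{1+η}} w(d) = o(x)`   (every `f`, every `η > 0`).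

A deep tuple has a COFACTOR `E := F(n)/L ∈ ℕ` (`L ∣ F(n)` because `dᵢ ∣ fᵢ(n) ∣ F(n)`); after the
exchange of summations the `n`-sum of a fixed `(E, root class)` is an arithmetic progression of modulus
`≤ E` ("pencil") met `≍ x/E` times by the weight `e^{-n/x}`.  The line cuts the deep range EXACTLY along
the cofactor, at the length of the `n`-range:

* PENCIL CELL  `L > x^{1+η}` and `F(n) < x·L`  (cofactor `E < x`: every pencil is met at least once;
  `μ` sits on the huge divisor `L > F(n)/x`, read through the small cofactor — Möbius randomness of
  `F(n)/E` along the root classes of `f mod E`; its `E = 1` member is the smooth log-weighted `k`-point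
  polynomial Chowla sum `Σ e^{-n/x} ∏ μ(fᵢ(n)) log fᵢ(n)`).  Stub `stub_pencilCell` (every system).
* BALANCED CELL  `L > x^{1+η}` and `x·L ≤ F(n)`  (cofactor `E ≥ x` AND divisor side `L > x^{1+η}`:
  both factorisation sides exceed the length of the `n`-range — incomplete on the modulus side
  (`ρ(L)·x/L < 1` expected solutions per modulus) and on the pencil side (empty classes); the
  "balanced factorisations `d, e > x` with no Type-I/II structure" of the route's why-it-might-fail,
  Ford–Maynard thin-set cell).  It forces `F(n) > x^{2+η}`, so for systems of total degree
  `G = Σ deg fᵢ ≤ 2` (one quadratic; a linear pair; `(X)`) only `n ≫ x^{1+η/2}` contribute and the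
  weight `e^{-n/x} ≤ exp(-c·x^{η/2})` makes the cell trivially `o(x)` — stub
  `stub_balancedCell_lowDegree` (PROVABLE NOW, pure size bookkeeping); the content lives in
  `G ≥ 3` — stub `stub_balancedCell` (divisors `L ∈ (x^{1+η}, F(n)/x] ≈ (x^{1+η}, x^{G-1}]`:
  `μ`-twisted small-root statistics of moduli beyond `x` at shrinking resolution `x/L`).

`Deep_η = Pencil_η + Balanced_η` termwise (`deep_eq_pencil_add_balanced`, proved), so
`stub_pencilCell → stub_balancedCell → stub_balancedCell_lowDegree → DeepTail` by `IsLittleO.add` and a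
case split on `G` (`DeepTail_of`, proved; hypothesis form as the `example` next to it).  The split is a
LOCALISATION of the route's designated parity atom (rank 2), not a redirect: for `G ≤ 2` systems
(twins, `n² + 1`) the pencil cell is the whole crux once the low-degree stub is discharged; the two open
cells differ in kind by where `μ` can be read (cofactor side / modulus side).  The conjunction of the
cells is formally STRONGER than the crux (no converse is claimed: the cells could cancel each other).

Disproof used: none relevant — no `Disproof.lean` and no `Negative/` lemma exist for this crux
(`ledger crux ls stmt-Parity-16277`: no workfiles, 2026-08-17); `ledger negatives --problem Parity`
lists three GHL-side statements (stmt-Parity-9541, 14832, 4218), none about divisor-tuple cells.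
-/

namespace Summit.Parity.BatemanHorn.Cruxes.DeepTail.Birth

open scoped BigOperators
open Filter Asymptotics

/-! ### Registered stubs (the only `sorry`s of the line) -/

/-- stub (PENCIL CELL — cofactor below the length; the parity core of the crux, every system):
for every Bateman–Horn system `f` and every `η > 0`,
`Σ_{n ≤ x²} e^{-n/x} Σ_{dᵢ ∣ fᵢ(n), lcm d > x^{1+η}, F(n) < x·lcm d} ∏ᵢ μ(dᵢ) log dᵢ = o(x)`,
`F(n) = ∏ᵢ fᵢ(n)`.  Why plausibly true: Möbius randomness of the large cofactor-free part
`F(n)/E` (`E = F(n)/lcm d < x`) along the root classes of `f mod E`, each met `≍ x/E ≥ 1` times;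
no main term crosses the seam (for a random integer `m` of size `X` the cell mean is
`Σ_{E<x} X⁻¹ Σ_{m' ≤ X/E} μ(m') log m' = o(1)` by the prime number theorem).  Contains (`E = 1`)
the smooth log-weighted polynomial / `k`-point Chowla sum; for total degree `≤ 2` it is all of
`DeepTail`.  Size: open problem (Selberg parity; cf. items stmt-Parity-0871/0872). -/
theorem stub_pencilCell :
    ∀ (k : ℕ) (f : Fin k → Polynomial ℤ), Literature.NumberTheory.Sieve.IsBatemanHornSystem f →
    ∀ η : ℝ, 0 < η →
    (fun x : ℕ => ∑ n ∈ Finset.Icc 1 (x ^ 2), Real.exp (-((n : ℝ) / x)) *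
      ∑ d ∈ Fintype.piFinset (fun i => (((f i).eval (n : ℤ)).toNat).divisors),
        if (x : ℝ) ^ (1 + η) < ((Finset.univ.lcm d : ℕ) : ℝ) ∧
            ((∏ i, ((f i).eval (n : ℤ)).toNat : ℕ) : ℝ) < (x : ℝ) * ((Finset.univ.lcm d : ℕ) : ℝ) then
          ∏ i, ((ArithmeticFunction.moebius (d i) : ℝ) * Real.log (d i)) else 0)
      =o[atTop] fun x : ℕ => (x : ℝ) := by
  sorry

/-- stub (BALANCED CELL, total degree `≥ 3` — both factorisation sides beyond the length):
for every Bateman–Horn system `f` with `Σᵢ deg fᵢ ≥ 3` and every `η > 0`,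
`Σ_{n ≤ x²} e^{-n/x} Σ_{dᵢ ∣ fᵢ(n), lcm d > x^{1+η}, x·lcm d ≤ F(n)} ∏ᵢ μ(dᵢ) log dᵢ = o(x)`.
Here `lcm d ∈ (x^{1+η}, F(n)/x]` (≈ `(x^{1+η}, x^{G-1}]`, `G` the total degree): the modulus carrying
`μ` exceeds the `n`-range (expected `ρ(L)x/L < 1` small roots per modulus) and so does the cofactor
(`≥ x`: empty pencils) — the thin-set cell with no Type-I/II structure (Ford–Maynard 2024 §2.4).
Why plausibly true: Möbius randomness; in modulus-side language it is a `μ`-twisted statistic of the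
joint roots `ν < x·polylog` of `f mod L` over `L ~ D ∈ (x^{1+η}, x^{G-1}]`, total mass `≍ x` per dyadic
`D`, where root equidistribution with a rate is known only for prime moduli in degree 2 (DFI 1995,
Tóth 2000) and with a `(log)^{-δ}` saving in general (Hooley 1964).  Size: open problem. -/
theorem stub_balancedCell :
    ∀ (k : ℕ) (f : Fin k → Polynomial ℤ), Literature.NumberTheory.Sieve.IsBatemanHornSystem f →
    3 ≤ ∑ i, (f i).natDegree →
    ∀ η : ℝ, 0 < η →
    (fun x : ℕ => ∑ n ∈ Finset.Icc 1 (x ^ 2), Real.exp (-((n : ℝ) / x)) *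
      ∑ d ∈ Fintype.piFinset (fun i => (((f i).eval (n : ℤ)).toNat).divisors),
        if (x : ℝ) ^ (1 + η) < ((Finset.univ.lcm d : ℕ) : ℝ) ∧
            (x : ℝ) * ((Finset.univ.lcm d : ℕ) : ℝ) ≤ ((∏ i, ((f i).eval (n : ℤ)).toNat : ℕ) : ℝ) then
          ∏ i, ((ArithmeticFunction.moebius (d i) : ℝ) * Real.log (d i)) else 0)
      =o[atTop] fun x : ℕ => (x : ℝ) := by
  sorry

/-- stub (BALANCED CELL IS EMPTY IN TOTAL DEGREE `≤ 2` — provable now, size bookkeeping):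
for every Bateman–Horn system `f` with `Σᵢ deg fᵢ ≤ 2` (the empty system, `(aX+b)`, one quadratic,
a linear pair) and every `η > 0`, the balanced cell is `o(x)`.  Proof plan: a term survives only if
`F(n) ≥ x·lcm d > x^{2+η}`; with `F(n) ≤ C_f·n²` for `n ≥ 1` this forces `n > x^{1+η/2}/√C_f`, where
`e^{-n/x} ≤ exp(-x^{η/2}/√C_f)`; the number of pairs `(n, d)` with `n ≤ x²` is `≤ x²·∏ᵢ fᵢ(n) ≤
C·x^{2+4}` (crudely `τ(m) ≤ m`) and `|∏ μ(dᵢ) log dᵢ| ≤ ∏ dᵢ ≤ C·x⁴`, so the cell is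
`O(x^{10} exp(-x^{η/2}/√C_f)) = o(x)`.  Mathlib: `Real.exp`, `Real.rpow` monotonicity,
`Polynomial` growth (`natDegree`, `eval` bounds), `Nat.card_divisors_le_self`.  Size: M. -/
theorem stub_balancedCell_lowDegree :
    ∀ (k : ℕ) (f : Fin k → Polynomial ℤ), Literature.NumberTheory.Sieve.IsBatemanHornSystem f →
    ∑ i, (f i).natDegree ≤ 2 →
    ∀ η : ℝ, 0 < η →
    (fun x : ℕ => ∑ n ∈ Finset.Icc 1 (x ^ 2), Real.exp (-((n : ℝ) / x)) *
      ∑ d ∈ Fintype.piFinset (fun i => (((f i).eval (n : ℤ)).toNat).divisors),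
        if (x : ℝ) ^ (1 + η) < ((Finset.univ.lcm d : ℕ) : ℝ) ∧
            (x : ℝ) * ((Finset.univ.lcm d : ℕ) : ℝ) ≤ ((∏ i, ((f i).eval (n : ℤ)).toNat : ℕ) : ℝ) then
          ∏ i, ((ArithmeticFunction.moebius (d i) : ℝ) * Real.log (d i)) else 0)
      =o[atTop] fun x : ℕ => (x : ℝ) := by
  sorry

/-! ### Glue (all proved): the cofactor cut is exact -/

/-- The weight `∏ᵢ μ(dᵢ) log dᵢ` of a divisor tuple. -/
noncomputable def weight {k : ℕ} (d : Fin k → ℕ) : ℝ :=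
  ∏ i, ((ArithmeticFunction.moebius (d i) : ℝ) * Real.log (d i))

/-- `F(n) = ∏ᵢ fᵢ(n)` with the route's `toNat` convention, cast to `ℝ`. -/
noncomputable def valueProd {k : ℕ} (f : Fin k → Polynomial ℤ) (n : ℕ) : ℝ :=
  ((∏ i, ((f i).eval (n : ℤ)).toNat : ℕ) : ℝ)

/-- The crux's deep sum `Deep_η(x)` (verbatim the function in `LambertRoots.DeepTail`). -/
noncomputable def deepSum {k : ℕ} (f : Fin k → Polynomial ℤ) (η : ℝ) (x : ℕ) : ℝ :=
  ∑ n ∈ Finset.Icc 1 (x ^ 2), Real.exp (-((n : ℝ) / x)) *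
    ∑ d ∈ Fintype.piFinset (fun i => (((f i).eval (n : ℤ)).toNat).divisors),
      if (x : ℝ) ^ (1 + η) < ((Finset.univ.lcm d : ℕ) : ℝ) then weight d else 0

/-- The pencil cell `lcm d > x^{1+η} ∧ F(n) < x·lcm d` (the function in `stub_pencilCell`). -/
noncomputable def pencilSum {k : ℕ} (f : Fin k → Polynomial ℤ) (η : ℝ) (x : ℕ) : ℝ :=
  ∑ n ∈ Finset.Icc 1 (x ^ 2), Real.exp (-((n : ℝ) / x)) *
    ∑ d ∈ Fintype.piFinset (fun i => (((f i).eval (n : ℤ)).toNat).divisors),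
      if (x : ℝ) ^ (1 + η) < ((Finset.univ.lcm d : ℕ) : ℝ) ∧
          valueProd f n < (x : ℝ) * ((Finset.univ.lcm d : ℕ) : ℝ) then weight d else 0

/-- The balanced cell `lcm d > x^{1+η} ∧ x·lcm d ≤ F(n)` (the function in the two balanced stubs). -/
noncomputable def balancedSum {k : ℕ} (f : Fin k → Polynomial ℤ) (η : ℝ) (x : ℕ) : ℝ :=
  ∑ n ∈ Finset.Icc 1 (x ^ 2), Real.exp (-((n : ℝ) / x)) *
    ∑ d ∈ Fintype.piFinset (fun i => (((f i).eval (n : ℤ)).toNat).divisors),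
      if (x : ℝ) ^ (1 + η) < ((Finset.univ.lcm d : ℕ) : ℝ) ∧
          (x : ℝ) * ((Finset.univ.lcm d : ℕ) : ℝ) ≤ valueProd f n then weight d else 0

/-- **The cut is exact.** For every system, `η` and `x`: `Deep_η(x) = Pencil_η(x) + Balanced_η(x)`
(the brackets `F(n) < x·L` / `x·L ≤ F(n)` are complementary inside `x^{1+η} < L`). [folklore] -/
theorem deep_eq_pencil_add_balanced {k : ℕ} (f : Fin k → Polynomial ℤ) (η : ℝ) (x : ℕ) :
    deepSum f η x = pencilSum f η x + balancedSum f η x := by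
  unfold deepSum pencilSum balancedSum
  rw [← Finset.sum_add_distrib]
  refine Finset.sum_congr rfl fun n _ => ?_
  rw [← mul_add, ← Finset.sum_add_distrib]
  congr 1
  refine Finset.sum_congr rfl fun d _ => ?_
  by_cases hA : (x : ℝ) ^ (1 + η) < ((Finset.univ.lcm d : ℕ) : ℝ)
  · by_cases hB : valueProd f n < (x : ℝ) * ((Finset.univ.lcm d : ℕ) : ℝ)
    · rw [if_pos hA, if_pos ⟨hA, hB⟩, if_neg (fun h => (not_le.mpr hB) h.2), add_zero]
    · rw [if_pos hA, if_neg (fun h => hB h.2), if_pos ⟨hA, not_lt.mp hB⟩, zero_add]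
  · rw [if_neg hA, if_neg (fun h => hA h.1), if_neg (fun h => hA h.1), add_zero]

/-! ### Composition: the three stubs give the crux BY NAME -/

/-- The pencil cell of every system is `o(x)` (stub, by name). -/
theorem pencil_of_stub {k : ℕ} (f : Fin k → Polynomial ℤ)
    (hf : Literature.NumberTheory.Sieve.IsBatemanHornSystem f) {η : ℝ} (hη : 0 < η) :
    (fun x : ℕ => pencilSum f η x) =o[atTop] fun x : ℕ => (x : ℝ) :=
  stub_pencilCell k f hf η hη

/-- The balanced cell of every system is `o(x)`: case split on the total degree (`≥ 3`: the open
stub; `≤ 2`: the provable-now stub). -/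
theorem balanced_of_stubs {k : ℕ} (f : Fin k → Polynomial ℤ)
    (hf : Literature.NumberTheory.Sieve.IsBatemanHornSystem f) {η : ℝ} (hη : 0 < η) :
    (fun x : ℕ => balancedSum f η x) =o[atTop] fun x : ℕ => (x : ℝ) := by
  by_cases hG : 3 ≤ ∑ i, (f i).natDegree
  · exact stub_balancedCell k f hf hG η hη
  · exact stub_balancedCell_lowDegree k f hf (by omega) η hη

/-- THE SKELETON THEOREM: the crux `LambertRoots.DeepTail`, concluded BY NAME from the three
registered stubs (no `sorry` here; `#print axioms` today = the stubs' `sorryAx` + the standard three). -/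
theorem DeepTail_of : Summit.Parity.BatemanHorn.Theses.LambertRoots.DeepTail := by
  intro k f hf η hη
  exact ((pencil_of_stub f hf hη).add (balanced_of_stubs f hf hη)).congr_left
    fun x => (deep_eq_pencil_add_balanced f η x).symm

/-- ASSEMBLY IN HYPOTHESIS FORM (kernel-checked, sorry-free): `stub_pencilCell-sig →
stub_balancedCell-sig → stub_balancedCell_lowDegree-sig → DeepTail`. -/
example :
    (∀ (k : ℕ) (f : Fin k → Polynomial ℤ), Literature.NumberTheory.Sieve.IsBatemanHornSystem f →
    ∀ η : ℝ, 0 < η →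
    (fun x : ℕ => ∑ n ∈ Finset.Icc 1 (x ^ 2), Real.exp (-((n : ℝ) / x)) *
      ∑ d ∈ Fintype.piFinset (fun i => (((f i).eval (n : ℤ)).toNat).divisors),
        if (x : ℝ) ^ (1 + η) < ((Finset.univ.lcm d : ℕ) : ℝ) ∧
            ((∏ i, ((f i).eval (n : ℤ)).toNat : ℕ) : ℝ) < (x : ℝ) * ((Finset.univ.lcm d : ℕ) : ℝ) then
          ∏ i, ((ArithmeticFunction.moebius (d i) : ℝ) * Real.log (d i)) else 0)
      =o[atTop] fun x : ℕ => (x : ℝ)) →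
    (∀ (k : ℕ) (f : Fin k → Polynomial ℤ), Literature.NumberTheory.Sieve.IsBatemanHornSystem f →
    3 ≤ ∑ i, (f i).natDegree →
    ∀ η : ℝ, 0 < η →
    (fun x : ℕ => ∑ n ∈ Finset.Icc 1 (x ^ 2), Real.exp (-((n : ℝ) / x)) *
      ∑ d ∈ Fintype.piFinset (fun i => (((f i).eval (n : ℤ)).toNat).divisors),
        if (x : ℝ) ^ (1 + η) < ((Finset.univ.lcm d : ℕ) : ℝ) ∧
            (x : ℝ) * ((Finset.univ.lcm d : ℕ) : ℝ) ≤ ((∏ i, ((f i).eval (n : ℤ)).toNat : ℕ) : ℝ) then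
          ∏ i, ((ArithmeticFunction.moebius (d i) : ℝ) * Real.log (d i)) else 0)
      =o[atTop] fun x : ℕ => (x : ℝ)) →
    (∀ (k : ℕ) (f : Fin k → Polynomial ℤ), Literature.NumberTheory.Sieve.IsBatemanHornSystem f →
    ∑ i, (f i).natDegree ≤ 2 →
    ∀ η : ℝ, 0 < η →
    (fun x : ℕ => ∑ n ∈ Finset.Icc 1 (x ^ 2), Real.exp (-((n : ℝ) / x)) *
      ∑ d ∈ Fintype.piFinset (fun i => (((f i).eval (n : ℤ)).toNat).divisors),
        if (x : ℝ) ^ (1 + η) < ((Finset.univ.lcm d : ℕ) : ℝ) ∧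
            (x : ℝ) * ((Finset.univ.lcm d : ℕ) : ℝ) ≤ ((∏ i, ((f i).eval (n : ℤ)).toNat : ℕ) : ℝ) then
          ∏ i, ((ArithmeticFunction.moebius (d i) : ℝ) * Real.log (d i)) else 0)
      =o[atTop] fun x : ℕ => (x : ℝ)) →
    Summit.Parity.BatemanHorn.Theses.LambertRoots.DeepTail := by
  intro h₁ h₂ h₃ k f hf η hη
  have hP : (fun x : ℕ => pencilSum f η x) =o[atTop] fun x : ℕ => (x : ℝ) := h₁ k f hf η hη
  have hB : (fun x : ℕ => balancedSum f η x) =o[atTop] fun x : ℕ => (x : ℝ) := by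
    by_cases hG : 3 ≤ ∑ i, (f i).natDegree
    · exact h₂ k f hf hG η hη
    · exact h₃ k f hf (by omega) η hη
  exact (hP.add hB).congr_left fun x => (deep_eq_pencil_add_balanced f η x).symm

end Summit.Parity.BatemanHorn.Cruxes.DeepTail.Birth
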